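import Literature.NumberTheory.ConnesConsani2021.ProlateContinuation
import Literature.NumberTheory.ConnesConsani2021.EpsSlopeFrobeniusToolkit
import HarnessLib

/-!
# The terms `τ(n)T_n(ρ)` of (97)/(98) in the currency of the Frobenius series at the band edge

RH-FREE corpus literature (label, line 1): real-analysis identities for Slepian's prolate functions at
bandwidth `c = 2π` (CC2021 §5 eq. (99) rewritten through the principal Frobenius solution `u_b` of the
prolate equation at `x = 1`); nothing in this file mentions `ζ`, the critical strip or RH, and nothing
here bears on the truth of RH.  bears_on (cell rh-crit, corpus C1): apex input (C) — route
«ConnesConsaniSemilocal» item K3 `WindowSpectralBound` (stmt 19306): the Tier-2 kernel certificate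
(seats cc-eng-1 g2 / cc-iso g4, cell rulings R110–R115 of 2026-08-26) encloses the finitely many terms
`τ(n)T_n(e^w)`, `n < 8`, of the frame `section6_enclosures_of_uniformVpanels_of_majorant` from
certified Frobenius data; this file is the LITERATURE SIDE of that read-back ("T2b"): exact
identities and truncation bounds, no numerics.

## What is here (all PROVED; 0 definitions, 0 named facts)

* `abs_frobSol_sub_sum_le_of_mem_Icc`, `abs_frobSol₁_add_sum_le_of_mem_Icc` — truncation tails of
  `u_b(x) = Σ a_k(1−x)^k` AND of `u_b′(x) = −Σ (k+1)a_{k+1}(1−x)^k` on the whole window `x ∈ [0,2]`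
  (`|1 − x| ≤ 1`): `Σ_k |a_{k+K}|`, resp. `Σ_k (k+K+1)|a_{k+K+1}|` (the toolkit
  `EpsSlopeFrobeniusToolkit` has `[0,1]` and `x = 0`);
* `ncard_zeros_frobSol_of_prolateFun_eq`, `prolateFun_one_eq_frobNormConst`,
  `sq_prolateFun_one_eq_inv_integral`, `prolateFunAn_eq_frobSol_of_prolateFun_eq`,
  `deriv_prolateFunAn_eq_frobSol₁_of_prolateFun_eq` — for a critical parameter `b` IDENTIFIED with
  the mode `n` (`prolateFun n = frobEvenExt b`, the output of
  `ArchKernelModeIdentification.eq_prolateFun_of_exists_index_of_eigen_strictMono`):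
  `ψ_n(1) = C_b`, `ψ_n(1)² = 1/(2∫₀¹u_b²)`, `ψ_n^{an} = C_b u_b` and `(ψ_n^{an})′ = C_b u_b′` on `(−1,3)`;
* **`sonineQTerm_prolateFun_eq_frob`** — eq. (99) with `C_b` pulled out:
  `τ(n)T_n(ρ) = (λ(n)²ψ_n(1)²/(1−λ(n)²)) · 2·[√ρ∫_{ρ⁻¹}^1 (x u_b′(x))(ρx u_b′(ρx))dx + ρ^{−3/2}u_b′(ρ⁻¹) − ρ^{3/2}u_b′(ρ)]`
  for `ρ ∈ [1,2]` (the prefactor is the certificate's exported row `λ²ψ(1)²`; no sign of `C_b`);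
  `sonineQTerm_prolateFun_exp_eq_frob` — the same at `ρ = e^w`, `w ∈ [0, log 2]`, powers of `ρ`
  as exponentials;
* `abs_sonineBracket_sub_le` — replacing `u_b′` by polynomial truncations `F` (inner range
  `[½,1]`) and `G` (outer range `[1,2]`) in that bracket costs at most
  `√2(δ₁(A₂+δ₂) + A₁δ₂) + δ₁ + 2√2·δ₂`, uniformly in `ρ ∈ [1,2]`;
  `abs_sonineQTerm_prolateFun_sub_le` — the two combined, mode by mode (the ONE real inequality by
  which the certificate replaces `u_b′` by its certified Frobenius polynomials).

Sources: A. Connes, C. Consani, *Weil positivity and trace formula, the archimedean place*, Selecta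
Math. (N.S.) 27 (2021) 77 = arXiv:2006.13771 [bib `ConnesConsani2021`], §5 Prop. 5.3 eqs. (97)–(99)
p. 32, App. F Lemma F.1 p. 55; E. A. Coddington, N. Levinson, *Theory of ODE* (1955), Ch. 4 §8
[bib `CoddingtonLevinson1955`] (Frobenius series at a regular singular point); D. Slepian,
H. O. Pollak, Bell Syst. Tech. J. 40 (1961) §III [bib `SlepianPollak1961`].

WHAT THIS FILE IS NOT: a certificate, an enclosure of any `T_n`, or anything about RH.
-/

noncomputable section

open Real Set MeasureTheory Filter Topology

namespace Literature.NumberTheory.LFunctions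

/-! ## Truncation tails of `u_b` and `u_b′` on `[0, 2]` -/

/-- `|Σ' f| ≤ Σ' |f|` for an absolutely summable real sequence. [folklore] -/
private theorem abs_tsum_le' {f : ℕ → ℝ} (hf : Summable (fun i ↦ |f i|)) :
    |∑' i, f i| ≤ ∑' i, |f i| := by
  have h := norm_tsum_le_tsum_norm (f := f) (by simpa [Real.norm_eq_abs] using hf)
  simpa [Real.norm_eq_abs] using h

/-- RH-FREE. **Truncation of `u_b` on `[0,2]`** (`|1 − x| ≤ 1` there):
`|u_b(x) − Σ_{k<K} a_k(1−x)^k| ≤ Σ_k |a_{k+K}|`.  Extends the toolkit's `[0,1]` version to the outer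
arguments `ρx ∈ [1,2]` of (99). [cite: CoddingtonLevinson1955, Ch. 4 §8; ConnesConsani2021, §5 eq. (99) p. 32] -/
theorem abs_frobSol_sub_sum_le_of_mem_Icc (b : ℝ) {x : ℝ} (hx : x ∈ Icc (0 : ℝ) 2) (K : ℕ) :
    |frobSol 1 b x - ∑ k ∈ Finset.range K, frobCoeff 1 b k * (1 - x) ^ k|
      ≤ ∑' k, |frobCoeff 1 b (k + K)| := by
  have ht : |1 - x| ≤ 1 := abs_le.2 ⟨by linarith [hx.2], by linarith [hx.1]⟩
  have hpow : ∀ k : ℕ, |(1 - x) ^ k| ≤ 1 := fun k ↦ by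
    rw [abs_pow]; exact pow_le_one₀ (abs_nonneg _) ht
  have hs : Summable (fun k ↦ frobCoeff 1 b k * (1 - x) ^ k) := by
    refine Summable.of_norm_bounded (summable_abs_frobCoeff_one b) fun k ↦ ?_
    rw [Real.norm_eq_abs, abs_mul]
    exact mul_le_of_le_one_right (abs_nonneg _) (hpow k)
  rw [frobSol, ← hs.sum_add_tsum_nat_add K, add_sub_cancel_left]
  have hsK : Summable (fun k ↦ |frobCoeff 1 b (k + K) * (1 - x) ^ (k + K)|) :=
    ((summable_nat_add_iff (f := fun k ↦ frobCoeff 1 b k * (1 - x) ^ k) K).mpr hs).abs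
  refine (abs_tsum_le' hsK).trans ?_
  refine hsK.tsum_le_tsum (fun k ↦ ?_) (summable_abs_frobCoeff_one_add b K)
  rw [abs_mul]
  exact mul_le_of_le_one_right (abs_nonneg _) (hpow _)

/-- RH-FREE. **Truncation of `u_b′` on `[0,2]`**:
`|u_b′(x) + Σ_{k<K}(k+1)a_{k+1}(1−x)^k| ≤ Σ_k (k+K+1)|a_{k+K+1}|` — the derivative series
`u_b′(x) = −Σ_k (k+1)a_{k+1}(1−x)^k` (`frobSol₁`) truncated, `|1 − x| ≤ 1`.
[cite: CoddingtonLevinson1955, Ch. 4 §8; ConnesConsani2021, §5 eq. (99) p. 32] -/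
theorem abs_frobSol₁_add_sum_le_of_mem_Icc (b : ℝ) {x : ℝ} (hx : x ∈ Icc (0 : ℝ) 2) (K : ℕ) :
    |frobSol₁ 1 b x + ∑ k ∈ Finset.range K, ((k : ℝ) + 1) * frobCoeff 1 b (k + 1) * (1 - x) ^ k|
      ≤ ∑' k : ℕ, (((k + K : ℕ) : ℝ) + 1) * |frobCoeff 1 b (k + K + 1)| := by
  have ht : |1 - x| ≤ 1 := abs_le.2 ⟨by linarith [hx.2], by linarith [hx.1]⟩
  have hpow : ∀ k : ℕ, |(1 - x) ^ k| ≤ 1 := fun k ↦ by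
    rw [abs_pow]; exact pow_le_one₀ (abs_nonneg _) ht
  have hs : Summable (fun k : ℕ ↦ ((k : ℝ) + 1) * frobCoeff 1 b (k + 1) * (1 - x) ^ k) := by
    refine Summable.of_norm_bounded (summable_succ_mul_abs_frobCoeff_one b) fun k ↦ ?_
    rw [Real.norm_eq_abs, abs_mul, abs_mul, abs_of_nonneg (by positivity : (0 : ℝ) ≤ (k : ℝ) + 1)]
    exact mul_le_of_le_one_right (by positivity) (hpow k)
  have key : frobSol₁ 1 b x + ∑ k ∈ Finset.range K, ((k : ℝ) + 1) * frobCoeff 1 b (k + 1) * (1 - x) ^ k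
      = -∑' k : ℕ, (((k + K : ℕ) : ℝ) + 1) * frobCoeff 1 b (k + K + 1) * (1 - x) ^ (k + K) := by
    rw [frobSol₁, ← hs.sum_add_tsum_nat_add K]
    push_cast
    ring
  have hsK : Summable (fun k : ℕ ↦
      |(((k + K : ℕ) : ℝ) + 1) * frobCoeff 1 b (k + K + 1) * (1 - x) ^ (k + K)|) := by
    have h := ((summable_nat_add_iff
      (f := fun k : ℕ ↦ ((k : ℝ) + 1) * frobCoeff 1 b (k + 1) * (1 - x) ^ k) K).mpr hs).abs
    refine h.congr fun k ↦ ?_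
    push_cast
    ring_nf
  have hmaj : Summable (fun k : ℕ ↦ (((k + K : ℕ) : ℝ) + 1) * |frobCoeff 1 b (k + K + 1)|) := by
    have h := (summable_nat_add_iff
      (f := fun k : ℕ ↦ ((k : ℝ) + 1) * |frobCoeff 1 b (k + 1)|) K).mpr
      (summable_succ_mul_abs_frobCoeff_one b)
    refine h.congr fun k ↦ ?_
    push_cast
    ring_nf
  rw [key, abs_neg]
  refine (abs_tsum_le' hsK).trans ?_
  refine hsK.tsum_le_tsum (fun k ↦ ?_) hmaj
  rw [abs_mul, abs_mul, abs_of_nonneg (by positivity : (0 : ℝ) ≤ ((k + K : ℕ) : ℝ) + 1)]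
  exact mul_le_of_le_one_right (by positivity) (hpow _)

end Literature.NumberTheory.LFunctions

namespace Literature.NumberTheory.ConnesConsani2021

open Literature.NumberTheory.LFunctions

/-! ## A critical Frobenius parameter identified with the mode `n` -/

/-- RH-FREE. If `ψ_n` is the normalised even extension of `u_b` (`b` critical), then `u_b` has exactly
`n` zeros in `(0,1)` (both are `IsProlateFunction 1 (2·#zeros)`; the zero count is part of the
structure). [cite: ConnesConsani2021, §4 p. 16 (arXiv p0016:L17–L28); SlepianPollak1961, §III] -/
theorem ncard_zeros_frobSol_of_prolateFun_eq {b : ℝ} {n : ℕ} (hB : frobSol₁ 1 b 0 = 0)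
    (h : prolateFun n = frobEvenExt b) :
    {x | x ∈ Ioo (0 : ℝ) 1 ∧ frobSol 1 b x = 0}.ncard = n := by
  have hP := (isProlateFunction_frobEvenExt hB rfl).1
  rw [← h] at hP
  have h1 := hP.zeros_card
  have h2 := (isProlateFunction_prolateFun n).zeros_card
  rw [h1] at h2
  omega

/-- RH-FREE. `ψ_n(1) = C_b` (`u_b(1) = 1`). [cite: ConnesConsani2021, Lemma 5.4 proof §5 p. 33; CoddingtonLevinson1955, Ch. 4 §8] -/
theorem prolateFun_one_eq_frobNormConst {b : ℝ} {n : ℕ} (h : prolateFun n = frobEvenExt b) :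
    prolateFun n 1 = frobNormConst b := by
  rw [h, frobEvenExt, if_pos (by norm_num), abs_one, frobSol_self, mul_one]

/-- RH-FREE. **`ψ_n(1)² = 1/(2∫₀¹u_b²)`** — the certificate's row `ψ(1)² = 1/(2I₂)`.
[cite: ConnesConsani2021, Lemma 5.4 §5 p. 33 (the terms `t(n)`); SlepianPollak1961, §III] -/
theorem sq_prolateFun_one_eq_inv_integral {b : ℝ} {n : ℕ} (h : prolateFun n = frobEvenExt b) :
    prolateFun n 1 ^ 2 = 1 / (2 * ∫ x in (0 : ℝ)..1, frobSol 1 b x ^ 2) := by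
  have hI := integral_frobSol_sq_pos one_pos b
  have hs1 : (if 0 < frobSol 1 b 0 then (1 : ℝ) else -1) ^ 2 = 1 := by split_ifs <;> norm_num
  rw [prolateFun_one_eq_frobNormConst h, frobNormConst, div_pow, hs1, Real.sq_sqrt (by positivity)]

/-- RH-FREE. **`ψ_n^{an} = C_b·u_b` on `(−1,3)`** for the identified parameter.
[cite: ConnesConsani2021, §5 p. 32, text before eq. (99); CoddingtonLevinson1955, Ch. 4 §8] -/
theorem prolateFunAn_eq_frobSol_of_prolateFun_eq {b : ℝ} {n : ℕ} (hB : frobSol₁ 1 b 0 = 0)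
    (h : prolateFun n = frobEvenExt b) {y : ℝ} (hy : y ∈ Ioo (-1 : ℝ) 3) :
    prolateFunAn n y = frobNormConst b * frobSol 1 b y :=
  prolateFunAn_eq_frobNormConst_mul_frobSol hB (ncard_zeros_frobSol_of_prolateFun_eq hB h) hy

/-- RH-FREE. **`(ψ_n^{an})′ = C_b·u_b′` on `(−1,3)`** for the identified parameter (term-wise
differentiation of the Frobenius series, `hasDerivAt_frobSol`).
[cite: ConnesConsani2021, §5 p. 32, text before eq. (99); CoddingtonLevinson1955, Ch. 4 §8] -/
theorem deriv_prolateFunAn_eq_frobSol₁_of_prolateFun_eq {b : ℝ} {n : ℕ} (hB : frobSol₁ 1 b 0 = 0)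
    (h : prolateFun n = frobEvenExt b) {y : ℝ} (hy : y ∈ Ioo (-1 : ℝ) 3) :
    deriv (prolateFunAn n) y = frobNormConst b * frobSol₁ 1 b y := by
  have hev : prolateFunAn n =ᶠ[𝓝 y] fun z ↦ frobNormConst b * frobSol 1 b z := by
    filter_upwards [isOpen_Ioo.mem_nhds hy] with z hz
      using prolateFunAn_eq_frobSol_of_prolateFun_eq hB h hz
  rw [hev.deriv_eq]
  have hy' : |1 - y| < 2 * 1 := abs_lt.2 ⟨by linarith [hy.2], by linarith [hy.1]⟩
  exact ((hasDerivAt_frobSol one_pos b hy').const_mul (frobNormConst b)).deriv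

/-! ## Eq. (99) in Frobenius currency -/

/-- RH-FREE. **`τ(n)T_n(ρ)` through `u_b′`**: for a critical `b` identified with the mode `n` and
`ρ ∈ [1,2]`,
`τ(n)T_n(ρ) = (λ(n)²ψ_n(1)²/(1−λ(n)²))·2·[ρ^{1/2}∫_{ρ⁻¹}^1 (x u_b′(x))(ρx u_b′(ρx))dx + ρ^{−3/2}u_b′(ρ⁻¹) − ρ^{3/2}u_b′(ρ)]`
— eq. (99) (`sonineQTerm_prolateFun_eq`) with `ψ_n^{an} = C_bu_b`, `(ψ_n^{an})′ = C_bu_b′` on the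
arguments `x, ρ⁻¹ ∈ [½,1]`, `ρx, ρ ∈ [1,2]`, and `C_b² = ψ_n(1)²` pulled out.  The prefactor is the
kernel certificate's exported row `λ²ψ(1)²` over `1 − λ²`; no sign of `C_b` enters.
[cite: ConnesConsani2021, §5 eq. (99) p. 32 (arXiv chunk p0020:L69–L78); CoddingtonLevinson1955, Ch. 4 §8] -/
theorem sonineQTerm_prolateFun_eq_frob {b : ℝ} {n : ℕ} (hB : frobSol₁ 1 b 0 = 0)
    (h : prolateFun n = frobEvenExt b) {ρ : ℝ} (hρ : ρ ∈ Icc (1 : ℝ) 2) :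
    sonineQTerm (prolateFun n) (prolateEigen n) ρ
      = prolateEigen n ^ 2 * prolateFun n 1 ^ 2 / (1 - prolateEigen n ^ 2) *
        (2 * (ρ ^ (1 / 2 : ℝ) * (∫ x in ρ⁻¹..1,
              (x * frobSol₁ 1 b x) * (ρ * x * frobSol₁ 1 b (ρ * x)))
          + ρ ^ (-(3 / 2) : ℝ) * frobSol₁ 1 b ρ⁻¹ - ρ ^ (3 / 2 : ℝ) * frobSol₁ 1 b ρ)) := by
  have hρ0 : 0 < ρ := by linarith [hρ.1]
  have hρi0 : 0 < ρ⁻¹ := inv_pos.2 hρ0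
  have hρi1 : ρ⁻¹ ≤ 1 := inv_le_one_of_one_le₀ hρ.1
  set C : ℝ := frobNormConst b with hC
  set u' : ℝ → ℝ := frobSol₁ 1 b with hu'
  -- `(ψ^{an})′ = C u′` at all the arguments that occur
  have hD : ∀ y ∈ Icc (ρ⁻¹) 2, deriv (prolateFunAn n) y = C * u' y := fun y hy ↦
    deriv_prolateFunAn_eq_frobSol₁_of_prolateFun_eq hB h ⟨by linarith [hy.1], by linarith [hy.2]⟩
  have hA1 : prolateFunAn n 1 = C := by
    rw [prolateFunAn_one, prolateFun_one_eq_frobNormConst h]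
  -- the integral
  have hint : ∫ x in ρ⁻¹..1, (x * deriv (prolateFunAn n) x) * (ρ * x * deriv (prolateFunAn n) (ρ * x))
      = C ^ 2 * ∫ x in ρ⁻¹..1, (x * u' x) * (ρ * x * u' (ρ * x)) := by
    rw [← intervalIntegral.integral_const_mul]
    refine intervalIntegral.integral_congr fun x hx ↦ ?_
    rw [uIcc_of_le hρi1] at hx
    have hx2 : x ∈ Icc (ρ⁻¹) 2 := ⟨hx.1, by linarith [hx.2]⟩
    have hρx : ρ * x ∈ Icc (ρ⁻¹) 2 := by
      constructor
      · calc ρ⁻¹ ≤ 1 := hρi1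
          _ = ρ * ρ⁻¹ := (mul_inv_cancel₀ hρ0.ne').symm
          _ ≤ ρ * x := mul_le_mul_of_nonneg_left hx.1 hρ0.le
      · calc ρ * x ≤ ρ * 1 := mul_le_mul_of_nonneg_left hx.2 hρ0.le
          _ ≤ 2 := by linarith [hρ.2]
    simp only [hD x hx2, hD (ρ * x) hρx]
    ring
  have hDi : deriv (prolateFunAn n) ρ⁻¹ = C * u' ρ⁻¹ := hD ρ⁻¹ ⟨le_rfl, by linarith⟩
  have hDρ : deriv (prolateFunAn n) ρ = C * u' ρ := hD ρ ⟨by linarith [hρ.1], hρ.2⟩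
  rw [sonineQTerm_prolateFun_eq n hρ.1, sonineCTerm, hint, hDi, hDρ, hA1,
    (prolateFun_one_eq_frobNormConst h : prolateFun n 1 = C)]
  ring

/-- RH-FREE. **The same at `ρ = e^w`, `w ∈ [0, log 2]`**, with the powers of `ρ` as exponentials
(`ρ^{1/2} = e^{w/2}`, `ρ^{∓3/2} = e^{∓3w/2}`, `ρ⁻¹ = e^{−w}`) — the shape a Taylor model in the additive
panel variable `w` consumes (frame `section6_enclosures_of_uniformVpanels_of_majorant`).
[cite: ConnesConsani2021, §5 eq. (99) p. 32 and eq. (101) p. 33 (additive scale); CoddingtonLevinson1955, Ch. 4 §8] -/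
theorem sonineQTerm_prolateFun_exp_eq_frob {b : ℝ} {n : ℕ} (hB : frobSol₁ 1 b 0 = 0)
    (h : prolateFun n = frobEvenExt b) {w : ℝ} (hw : w ∈ Icc (0 : ℝ) (Real.log 2)) :
    sonineQTerm (prolateFun n) (prolateEigen n) (Real.exp w)
      = prolateEigen n ^ 2 * prolateFun n 1 ^ 2 / (1 - prolateEigen n ^ 2) *
        (2 * (Real.exp (w / 2) * (∫ x in Real.exp (-w)..1,
              (x * frobSol₁ 1 b x) * (Real.exp w * x * frobSol₁ 1 b (Real.exp w * x)))
          + Real.exp (-(3 * w / 2)) * frobSol₁ 1 b (Real.exp (-w))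
          - Real.exp (3 * w / 2) * frobSol₁ 1 b (Real.exp w))) := by
  have hρ : Real.exp w ∈ Icc (1 : ℝ) 2 := by
    refine ⟨Real.one_le_exp hw.1, ?_⟩
    calc Real.exp w ≤ Real.exp (Real.log 2) := Real.exp_le_exp.2 hw.2
      _ = 2 := Real.exp_log two_pos
  rw [sonineQTerm_prolateFun_eq_frob hB h hρ]
  have e1 : Real.exp w ^ (1 / 2 : ℝ) = Real.exp (w / 2) := by
    rw [← Real.exp_mul]; ring_nf
  have e2 : Real.exp w ^ (-(3 / 2) : ℝ) = Real.exp (-(3 * w / 2)) := by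
    rw [← Real.exp_mul]; ring_nf
  have e3 : Real.exp w ^ (3 / 2 : ℝ) = Real.exp (3 * w / 2) := by
    rw [← Real.exp_mul]; ring_nf
  have e4 : (Real.exp w)⁻¹ = Real.exp (-w) := (Real.exp_neg w).symm
  rw [e1, e2, e3, e4]

/-! ## Replacing `u_b′` by polynomial truncations inside the bracket of (99) -/

/-- RH-FREE. **Perturbation of the bracket of (99)**: for `ρ ∈ [1,2]`, if `|f − F| ≤ δ₁`, `|F| ≤ A₁`
on the inner range `[½,1]` and `|g − G| ≤ δ₂`, `|G| ≤ A₂` on the outer range `[1,2]` (all four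
continuous there), then the brackets
`Φ(f,g)(ρ) = ρ^{1/2}∫_{ρ⁻¹}^1 (x f(x))(ρx g(ρx))dx + ρ^{−3/2}f(ρ⁻¹) − ρ^{3/2}g(ρ)` satisfy
`|Φ(f,g)(ρ) − Φ(F,G)(ρ)| ≤ √2·(δ₁(A₂+δ₂) + A₁δ₂) + δ₁ + 2√2·δ₂`
(`x ≤ 1`, `ρx ≤ 2`, `1 − ρ⁻¹ ≤ ½`, `ρ^{1/2} ≤ √2`, `ρ^{−3/2} ≤ 1`, `ρ^{3/2} ≤ 2√2`).  With
`f = g = u_b′` and `F`, `G` its Frobenius truncations (tails `abs_frobSol₁_add_sum_le_of_mem_Icc`)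
this is the truncation remainder of the certificate's Taylor models of `τ(n)T_n`.
[cite: ConnesConsani2021, §5 eq. (99) p. 32; App. F Lemma F.1 (arXiv Lemma 49) p. 55 (the same Schwarz-type bookkeeping)] -/
theorem abs_sonineBracket_sub_le {f F g G : ℝ → ℝ} {δ₁ δ₂ A₁ A₂ ρ : ℝ}
    (hf : ContinuousOn f (Icc (1 / 2) 1)) (hF : ContinuousOn F (Icc (1 / 2) 1))
    (hg : ContinuousOn g (Icc 1 2)) (hG : ContinuousOn G (Icc 1 2))
    (hfF : ∀ x ∈ Icc (1 / 2 : ℝ) 1, |f x - F x| ≤ δ₁) (hFA : ∀ x ∈ Icc (1 / 2 : ℝ) 1, |F x| ≤ A₁)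
    (hgG : ∀ y ∈ Icc (1 : ℝ) 2, |g y - G y| ≤ δ₂) (hGA : ∀ y ∈ Icc (1 : ℝ) 2, |G y| ≤ A₂)
    (hρ : ρ ∈ Icc (1 : ℝ) 2) :
    |(ρ ^ (1 / 2 : ℝ) * (∫ x in ρ⁻¹..1, (x * f x) * (ρ * x * g (ρ * x)))
        + ρ ^ (-(3 / 2) : ℝ) * f ρ⁻¹ - ρ ^ (3 / 2 : ℝ) * g ρ)
      - (ρ ^ (1 / 2 : ℝ) * (∫ x in ρ⁻¹..1, (x * F x) * (ρ * x * G (ρ * x)))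
        + ρ ^ (-(3 / 2) : ℝ) * F ρ⁻¹ - ρ ^ (3 / 2 : ℝ) * G ρ)|
      ≤ Real.sqrt 2 * (δ₁ * (A₂ + δ₂) + A₁ * δ₂) + δ₁ + 2 * Real.sqrt 2 * δ₂ := by
  have hρ0 : 0 < ρ := by linarith [hρ.1]
  have hρi0 : 0 < ρ⁻¹ := inv_pos.2 hρ0
  have hρi1 : ρ⁻¹ ≤ 1 := inv_le_one_of_one_le₀ hρ.1
  have hρih : 1 / 2 ≤ ρ⁻¹ := by
    rw [one_div, inv_le_inv₀ two_pos hρ0]; exact hρ.2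
  -- nonnegativity of the data (from the hypotheses at one point)
  have hone : (1 : ℝ) ∈ Icc (1 / 2 : ℝ) 1 := ⟨by norm_num, le_rfl⟩
  have hone' : (1 : ℝ) ∈ Icc (1 : ℝ) 2 := ⟨le_rfl, one_le_two⟩
  have hδ₁ : 0 ≤ δ₁ := le_trans (abs_nonneg _) (hfF 1 hone)
  have hδ₂ : 0 ≤ δ₂ := le_trans (abs_nonneg _) (hgG 1 hone')
  have hA₁ : 0 ≤ A₁ := le_trans (abs_nonneg _) (hFA 1 hone)
  have hA₂ : 0 ≤ A₂ := le_trans (abs_nonneg _) (hGA 1 hone')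
  -- ranges of the arguments
  have hxin : ∀ x ∈ Icc ρ⁻¹ 1, x ∈ Icc (1 / 2 : ℝ) 1 := fun x hx ↦ ⟨hρih.trans hx.1, hx.2⟩
  have hxout : ∀ x ∈ Icc ρ⁻¹ 1, ρ * x ∈ Icc (1 : ℝ) 2 := by
    intro x hx
    constructor
    · calc (1 : ℝ) = ρ * ρ⁻¹ := (mul_inv_cancel₀ hρ0.ne').symm
        _ ≤ ρ * x := mul_le_mul_of_nonneg_left hx.1 hρ0.le
    · calc ρ * x ≤ ρ * 1 := mul_le_mul_of_nonneg_left hx.2 hρ0.le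
        _ ≤ 2 := by linarith [hρ.2]
  -- `|g| ≤ A₂ + δ₂` on `[1,2]`
  have hgA : ∀ y ∈ Icc (1 : ℝ) 2, |g y| ≤ A₂ + δ₂ := by
    intro y hy
    have e : g y = G y + (g y - G y) := by ring
    rw [e]
    exact (abs_add_le _ _).trans (add_le_add (hGA y hy) (hgG y hy))
  -- continuity of the two integrands on `[ρ⁻¹, 1]`
  have hmul : ContinuousOn (fun x : ℝ ↦ ρ * x) (Icc ρ⁻¹ 1) := (continuous_const.mul continuous_id).continuousOn
  have hcont : ∀ {p q : ℝ → ℝ}, ContinuousOn p (Icc (1 / 2) 1) → ContinuousOn q (Icc 1 2) →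
      ContinuousOn (fun x ↦ (x * p x) * (ρ * x * q (ρ * x))) (Icc ρ⁻¹ 1) := by
    intro p q hp hq
    refine ((continuousOn_id.mul (hp.mono hxin))).mul (hmul.mul (hq.comp hmul hxout))
  have hi1 : IntervalIntegrable (fun x ↦ (x * f x) * (ρ * x * g (ρ * x))) volume ρ⁻¹ 1 :=
    (hcont hf hg).intervalIntegrable_of_Icc hρi1
  have hi2 : IntervalIntegrable (fun x ↦ (x * F x) * (ρ * x * G (ρ * x))) volume ρ⁻¹ 1 :=
    (hcont hF hG).intervalIntegrable_of_Icc hρi1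
  -- the integral part
  have hI : |(∫ x in ρ⁻¹..1, (x * f x) * (ρ * x * g (ρ * x)))
        - ∫ x in ρ⁻¹..1, (x * F x) * (ρ * x * G (ρ * x))|
      ≤ δ₁ * (A₂ + δ₂) + A₁ * δ₂ := by
    rw [← intervalIntegral.integral_sub hi1 hi2]
    have hb : ∀ x ∈ Set.uIoc ρ⁻¹ 1,
        ‖(x * f x) * (ρ * x * g (ρ * x)) - (x * F x) * (ρ * x * G (ρ * x))‖
          ≤ 2 * (δ₁ * (A₂ + δ₂) + A₁ * δ₂) := by
      intro x hx
      rw [uIoc_of_le hρi1] at hx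
      have hx' : x ∈ Icc ρ⁻¹ 1 := ⟨hx.1.le, hx.2⟩
      have hx0 : 0 ≤ x := hρi0.le.trans hx'.1
      have hx1 : x ≤ 1 := hx'.2
      have hρx2 : ρ * x ≤ 2 := (hxout x hx').2
      have hρx0 : 0 ≤ ρ * x := mul_nonneg hρ0.le hx0
      have e : (x * f x) * (ρ * x * g (ρ * x)) - (x * F x) * (ρ * x * G (ρ * x))
          = x * (ρ * x) * ((f x - F x) * g (ρ * x) + F x * (g (ρ * x) - G (ρ * x))) := by ring
      rw [Real.norm_eq_abs, e, abs_mul, abs_mul, abs_of_nonneg hx0, abs_of_nonneg hρx0]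
      have h1 : |(f x - F x) * g (ρ * x) + F x * (g (ρ * x) - G (ρ * x))|
          ≤ δ₁ * (A₂ + δ₂) + A₁ * δ₂ := by
        refine (abs_add_le _ _).trans ?_
        rw [abs_mul, abs_mul]
        exact add_le_add
          (mul_le_mul (hfF x (hxin x hx')) (hgA _ (hxout x hx')) (abs_nonneg _) hδ₁)
          (mul_le_mul (hFA x (hxin x hx')) (hgG _ (hxout x hx')) (abs_nonneg _) hA₁)
      have h0 : 0 ≤ δ₁ * (A₂ + δ₂) + A₁ * δ₂ := by positivity
      calc x * (ρ * x) * |(f x - F x) * g (ρ * x) + F x * (g (ρ * x) - G (ρ * x))|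
          ≤ 1 * 2 * (δ₁ * (A₂ + δ₂) + A₁ * δ₂) := by
            refine mul_le_mul (mul_le_mul hx1 hρx2 hρx0 zero_le_one) h1 (abs_nonneg _) (by norm_num)
        _ = 2 * (δ₁ * (A₂ + δ₂) + A₁ * δ₂) := by ring
    have h := intervalIntegral.norm_integral_le_of_norm_le_const hb
    rw [Real.norm_eq_abs] at h
    refine h.trans ?_
    have hlen : |1 - ρ⁻¹| ≤ 1 / 2 := by
      rw [abs_of_nonneg (by linarith)]; linarith
    have h0 : 0 ≤ 2 * (δ₁ * (A₂ + δ₂) + A₁ * δ₂) := by positivity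
    calc 2 * (δ₁ * (A₂ + δ₂) + A₁ * δ₂) * |1 - ρ⁻¹|
        ≤ 2 * (δ₁ * (A₂ + δ₂) + A₁ * δ₂) * (1 / 2) := mul_le_mul_of_nonneg_left hlen h0
      _ = δ₁ * (A₂ + δ₂) + A₁ * δ₂ := by ring
  -- bounds on the powers of `ρ`
  have hs2 : ρ ^ (1 / 2 : ℝ) ≤ Real.sqrt 2 := by
    rw [Real.sqrt_eq_rpow]; exact Real.rpow_le_rpow hρ0.le hρ.2 (by norm_num)
  have hs0 : 0 ≤ ρ ^ (1 / 2 : ℝ) := Real.rpow_nonneg hρ0.le _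
  have hm32 : ρ ^ (-(3 / 2) : ℝ) ≤ 1 := by
    rw [Real.rpow_neg hρ0.le]
    exact inv_le_one_of_one_le₀ (Real.one_le_rpow hρ.1 (by norm_num))
  have hm32' : 0 ≤ ρ ^ (-(3 / 2) : ℝ) := Real.rpow_nonneg hρ0.le _
  have h32 : ρ ^ (3 / 2 : ℝ) ≤ 2 * Real.sqrt 2 := by
    have e : (2 : ℝ) * Real.sqrt 2 = 2 ^ (3 / 2 : ℝ) := by
      rw [show (3 / 2 : ℝ) = 1 + 1 / 2 by norm_num, Real.rpow_add two_pos, Real.rpow_one,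
        Real.sqrt_eq_rpow]
    rw [e]; exact Real.rpow_le_rpow hρ0.le hρ.2 (by norm_num)
  have h32' : 0 ≤ ρ ^ (3 / 2 : ℝ) := Real.rpow_nonneg hρ0.le _
  -- the two boundary terms
  have hb1 : |ρ ^ (-(3 / 2) : ℝ) * f ρ⁻¹ - ρ ^ (-(3 / 2) : ℝ) * F ρ⁻¹| ≤ δ₁ := by
    rw [← mul_sub, abs_mul, abs_of_nonneg hm32']
    calc ρ ^ (-(3 / 2) : ℝ) * |f ρ⁻¹ - F ρ⁻¹| ≤ 1 * δ₁ :=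
          mul_le_mul hm32 (hfF _ ⟨hρih, hρi1⟩) (abs_nonneg _) zero_le_one
      _ = δ₁ := one_mul _
  have hb2 : |ρ ^ (3 / 2 : ℝ) * g ρ - ρ ^ (3 / 2 : ℝ) * G ρ| ≤ 2 * Real.sqrt 2 * δ₂ := by
    rw [← mul_sub, abs_mul, abs_of_nonneg h32']
    exact mul_le_mul h32 (hgG ρ hρ) (abs_nonneg _) (by positivity)
  -- assemble
  set I₁ := ∫ x in ρ⁻¹..1, (x * f x) * (ρ * x * g (ρ * x)) with hI₁
  set I₂ := ∫ x in ρ⁻¹..1, (x * F x) * (ρ * x * G (ρ * x)) with hI₂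
  have e : (ρ ^ (1 / 2 : ℝ) * I₁ + ρ ^ (-(3 / 2) : ℝ) * f ρ⁻¹ - ρ ^ (3 / 2 : ℝ) * g ρ)
      - (ρ ^ (1 / 2 : ℝ) * I₂ + ρ ^ (-(3 / 2) : ℝ) * F ρ⁻¹ - ρ ^ (3 / 2 : ℝ) * G ρ)
      = ρ ^ (1 / 2 : ℝ) * (I₁ - I₂) + (ρ ^ (-(3 / 2) : ℝ) * f ρ⁻¹ - ρ ^ (-(3 / 2) : ℝ) * F ρ⁻¹)
        - (ρ ^ (3 / 2 : ℝ) * g ρ - ρ ^ (3 / 2 : ℝ) * G ρ) := by ring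
  rw [e]
  set B₁ := ρ ^ (-(3 / 2) : ℝ) * f ρ⁻¹ - ρ ^ (-(3 / 2) : ℝ) * F ρ⁻¹ with hB₁
  set B₂ := ρ ^ (3 / 2 : ℝ) * g ρ - ρ ^ (3 / 2 : ℝ) * G ρ with hB₂
  have hA : |ρ ^ (1 / 2 : ℝ) * (I₁ - I₂)| ≤ Real.sqrt 2 * (δ₁ * (A₂ + δ₂) + A₁ * δ₂) := by
    rw [abs_mul, abs_of_nonneg hs0]
    exact mul_le_mul hs2 hI (abs_nonneg _) (Real.sqrt_nonneg _)
  have h1 : |ρ ^ (1 / 2 : ℝ) * (I₁ - I₂) + B₁ - B₂| ≤ |ρ ^ (1 / 2 : ℝ) * (I₁ - I₂) + B₁| + |B₂| :=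
    abs_sub _ _
  have h2 : |ρ ^ (1 / 2 : ℝ) * (I₁ - I₂) + B₁| ≤ |ρ ^ (1 / 2 : ℝ) * (I₁ - I₂)| + |B₁| :=
    abs_add_le _ _
  linarith

/-- RH-FREE. `u_b′` is continuous on `(−1, 3)` (it is differentiable there, `hasDerivAt_frobSol₁`).
[cite: CoddingtonLevinson1955, Ch. 4 §8] -/
theorem continuousOn_frobSol₁_Ioo (b : ℝ) : ContinuousOn (frobSol₁ 1 b) (Ioo (-1 : ℝ) 3) :=
  fun x hx ↦ (hasDerivAt_frobSol₁ one_pos b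
    (abs_lt.2 ⟨by linarith [hx.2], by linarith [hx.1]⟩)).continuousAt.continuousWithinAt

/-- RH-FREE. **Mode-level truncation estimate** — `sonineQTerm_prolateFun_eq_frob` combined with
`abs_sonineBracket_sub_le`: for a critical `b` identified with the mode `n`, `ρ ∈ [1,2]` and
polynomial (or any continuous) truncations `F` of `u_b′` on `[½,1]`, `G` of `u_b′` on `[1,2]` with
`|u_b′ − F| ≤ δ₁`, `|F| ≤ A₁`, `|u_b′ − G| ≤ δ₂`, `|G| ≤ A₂`:
`|τ(n)T_n(ρ) − (λ²ψ(1)²/(1−λ²))·2·Φ(F,G)(ρ)| ≤ (λ²ψ(1)²/(1−λ²))·2·(√2(δ₁(A₂+δ₂)+A₁δ₂) + δ₁ + 2√2δ₂)`.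
This is the one real inequality by which the Tier-2 kernel replaces `u_b′` by its certified
Frobenius polynomials (tails: `abs_frobSol₁_add_sum_le_of_mem_Icc`).
[cite: ConnesConsani2021, §5 eq. (99) p. 32; App. F Lemma F.1 (arXiv Lemma 49) p. 55; CoddingtonLevinson1955, Ch. 4 §8] -/
theorem abs_sonineQTerm_prolateFun_sub_le {b : ℝ} {n : ℕ} (hB : frobSol₁ 1 b 0 = 0)
    (h : prolateFun n = frobEvenExt b) {F G : ℝ → ℝ} {δ₁ δ₂ A₁ A₂ ρ : ℝ}
    (hF : ContinuousOn F (Icc (1 / 2) 1)) (hG : ContinuousOn G (Icc 1 2))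
    (hfF : ∀ x ∈ Icc (1 / 2 : ℝ) 1, |frobSol₁ 1 b x - F x| ≤ δ₁)
    (hFA : ∀ x ∈ Icc (1 / 2 : ℝ) 1, |F x| ≤ A₁)
    (hgG : ∀ y ∈ Icc (1 : ℝ) 2, |frobSol₁ 1 b y - G y| ≤ δ₂)
    (hGA : ∀ y ∈ Icc (1 : ℝ) 2, |G y| ≤ A₂) (hρ : ρ ∈ Icc (1 : ℝ) 2) :
    |sonineQTerm (prolateFun n) (prolateEigen n) ρ
      - prolateEigen n ^ 2 * prolateFun n 1 ^ 2 / (1 - prolateEigen n ^ 2) *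
        (2 * (ρ ^ (1 / 2 : ℝ) * (∫ x in ρ⁻¹..1, (x * F x) * (ρ * x * G (ρ * x)))
          + ρ ^ (-(3 / 2) : ℝ) * F ρ⁻¹ - ρ ^ (3 / 2 : ℝ) * G ρ))|
      ≤ prolateEigen n ^ 2 * prolateFun n 1 ^ 2 / (1 - prolateEigen n ^ 2) *
        (2 * (Real.sqrt 2 * (δ₁ * (A₂ + δ₂) + A₁ * δ₂) + δ₁ + 2 * Real.sqrt 2 * δ₂)) := by
  have hpref : 0 ≤ prolateEigen n ^ 2 * prolateFun n 1 ^ 2 / (1 - prolateEigen n ^ 2) := by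
    have h1 : prolateEigen n ^ 2 < 1 := by
      have ha := abs_prolateEigen_lt_one n
      have h0 := abs_nonneg (prolateEigen n)
      nlinarith [sq_abs (prolateEigen n)]
    have h2 : 0 < 1 - prolateEigen n ^ 2 := by linarith
    positivity
  have hf : ContinuousOn (frobSol₁ 1 b) (Icc (1 / 2) 1) :=
    (continuousOn_frobSol₁_Ioo b).mono fun x hx ↦ ⟨by linarith [hx.1], by linarith [hx.2]⟩
  have hg : ContinuousOn (frobSol₁ 1 b) (Icc 1 2) :=
    (continuousOn_frobSol₁_Ioo b).mono fun x hx ↦ ⟨by linarith [hx.1], by linarith [hx.2]⟩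
  have hΦ := abs_sonineBracket_sub_le hf hF hg hG hfF hFA hgG hGA hρ
  rw [sonineQTerm_prolateFun_eq_frob hB h hρ, ← mul_sub, ← mul_sub, abs_mul, abs_mul,
    abs_of_nonneg hpref, abs_two]
  exact mul_le_mul_of_nonneg_left (mul_le_mul_of_nonneg_left hΦ zero_le_two) hpref

end Literature.NumberTheory.ConnesConsani2021

end
-- (2026-08-26 13:52Z, t7 g3) comment-only re-land to re-trigger the farm build of this module (cc-lead R130; no declaration touched).
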